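import Summits.SmoothPoincare4.SmoothPoincare4.Theses.CongruenceShadows
import Literature.Topology.FourManifolds.SurfaceGroupGenusOne

/-!
# Stub `stub_framingZero` of line `epi-class-livingston` for crux `CongruenceShadows.ShadowApproximation`
(item stmt-SmoothPoincare4-14595, route route-SmoothPoincare4-CongruenceShadows) — part A:
the abelianisation `S₃ → ℤ⁶`, integer lattices of subgroups, coordinate sublattices, reduction mod `p`

First of five support files (`…StubFramingZeroAbelian` → `…Lattice` → `…Levels` → `…Handlebody`
→ `…StubFramingZero`) proving the genus-3 dictionary `stub_framingZero` (a Waldhausen-normalised,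
shadow-standard `(3;1,1,1)` group trisection of `{1}` admits a framing with the standard joint
image).  Genus `3`: `S₃ = SurfaceGroup 3` on `a₀,b₀,a₁,b₁,a₂,b₂` (`surfaceGen 3 = Fin 3 × Bool`).
Everything here is elementary bookkeeping, fully proved:

* `ab : S₃ →* Multiplicative (surfaceGen 3 → ℤ)` — the abelianisation in coordinates
  (`H₁(Σ₃;ℤ) = ℤ⁶`; the relator `∏[aᵢ,bᵢ]` dies in every commutative group, Hatcher §1.2 p. 51,
  `SurfaceGroup.toCommGroup`), `ab_surjective`; `factorAb F` — a hom `S₃ → C` to a commutative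
  group factors through `ab` (`factorAb_ab`);
* `abel φ`, `abelEquiv α` — the endomorphism / automorphism of `ℤ⁶` induced by an endomorphism /
  automorphism of `S₃` (`abel_ab : ab ∘ φ = abel φ ∘ ab`, functoriality);
* `L K ≤ ℤ⁶` — the image of a subgroup `K ≤ S₃`, an integer lattice (`ℤ`-submodule), with
  `L_map_equiv`, `L_sup`, `L_top`; `coord R A` — the coordinate submodule of vectors supported in
  a set `A` of generators; `L_normalClosure_image` : `L ⟪x : x ∈ A⟫ = coord ℤ A` (`ab` kills
  conjugation), whence **`L_s4Kernels`** : the standard kernels `Nᵢ = s4Kernels i` abelianise to the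
  coordinate sublattices `Cᵢ = coord ℤ (s4Gens i)` (the registered statement of this file);
* `red p : ℤ⁶ → (ZMod p)⁶` and the reduction `redSub p Λ` of an integer lattice, `redSub_coord`.

No new mathematics. [folklore]
-/

-- the prescribed namespace `Summit.<P>.<Sub>.…` duplicates `SmoothPoincare4` (P = Sub)
set_option linter.dupNamespace false
noncomputable section
open Literature.Topology.FourManifolds Multiplicative

namespace Summit.SmoothPoincare4.SmoothPoincare4.Theorems.ShadowApproximation.EpiClassLivingston

/-! ## The abelianisation `S₃ → ℤ⁶` -/

/-- `H₁(Σ₃; ℤ) = ℤ⁶` in the coordinates of the generators `a₀,…,b₂`. -/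
abbrev V3 : Type := surfaceGen 3 → ℤ

/-- The coordinate vector `e_x` of a generator. -/
abbrev e3 (x : surfaceGen 3) : V3 := Pi.single x 1

/-- **The abelianisation** `ab : S₃ → ℤ⁶`, `x ↦ e_x` on generators (the relator is a product of
commutators, so it dies in the commutative target). -/
def ab : SurfaceGroup 3 →* Multiplicative V3 :=
  SurfaceGroup.toCommGroup fun x => ofAdd (e3 x)

/-- `ab` on a generator. [folklore] -/
@[simp] theorem ab_of (x : surfaceGen 3) : ab (PresentedGroup.of x) = ofAdd (e3 x) :=
  SurfaceGroup.toCommGroup_of _ x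

/-- A vector is the sum of its coordinates times the basis vectors, multiplicatively. [folklore] -/
theorem prod_ofAdd_e3_zpow (v : V3) : (∏ x, ofAdd (e3 x) ^ v x) = ofAdd v := by
  rw [← ofAdd.apply_symm_apply (∏ x, ofAdd (e3 x) ^ v x)]
  congr 1
  change toAdd (∏ x, ofAdd (e3 x) ^ v x) = v
  rw [toAdd_prod]
  simp only [toAdd_zpow, toAdd_ofAdd]
  conv_rhs => rw [← Finset.univ_sum_single v]
  refine Finset.sum_congr rfl fun x _ => ?_
  ext y
  by_cases h : x = y
  · subst h; simp
  · simp [Pi.single_eq_of_ne' h]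

/-- `ab` is onto (`e_x = ab x`). [folklore] -/
theorem ab_surjective : Function.Surjective ab := by
  intro v
  have hv : ofAdd (toAdd v) ∈ ab.range := by
    rw [← prod_ofAdd_e3_zpow]
    exact Subgroup.prod_mem _ fun x _ =>
      Subgroup.zpow_mem _ (MonoidHom.mem_range.2 ⟨PresentedGroup.of x, ab_of x⟩) _
  simpa using hv

section factor

variable {C : Type*} [AddCommGroup C]

/-- The `ℤ`-linear extension `ℤ⁶ → C` of generator values. -/
def linExt (c : surfaceGen 3 → C) : V3 →ₗ[ℤ] C := Fintype.linearCombination ℤ c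

/-- `linExt c (e_x) = c x`. [folklore] -/
@[simp] theorem linExt_e3 (c : surfaceGen 3 → C) (x : surfaceGen 3) : linExt c (e3 x) = c x := by
  simp [linExt, e3]

/-- The factorisation through `ab` of a hom `F : S₃ → C` into a commutative group. -/
def factorAb (F : SurfaceGroup 3 →* Multiplicative C) : V3 →ₗ[ℤ] C :=
  linExt fun x => toAdd (F (PresentedGroup.of x))

/-- `factorAb F ∘ ab = F` as monoid homs. [folklore] -/
theorem factorAb_comp_ab (F : SurfaceGroup 3 →* Multiplicative C) :
    (AddMonoidHom.toMultiplicative (factorAb F).toAddMonoidHom).comp ab = F :=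
  PresentedGroup.ext fun x => by simp [factorAb]

/-- `factorAb F (ab s) = F s`. [folklore] -/
@[simp] theorem factorAb_ab (F : SurfaceGroup 3 →* Multiplicative C) (s : SurfaceGroup 3) :
    factorAb F (toAdd (ab s)) = toAdd (F s) := by
  conv_rhs => rw [← factorAb_comp_ab F]
  rfl

end factor

/-! ## Induced endomorphisms of `ℤ⁶` -/

/-- The endomorphism of `ℤ⁶ = H₁` induced by an endomorphism of `S₃`. -/
def abel (φ : SurfaceGroup 3 →* SurfaceGroup 3) : V3 →ₗ[ℤ] V3 :=
  factorAb (ab.comp φ)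

/-- `ab (φ s) = abel φ (ab s)`. [folklore] -/
@[simp] theorem abel_ab (φ : SurfaceGroup 3 →* SurfaceGroup 3) (s : SurfaceGroup 3) :
    abel φ (toAdd (ab s)) = toAdd (ab (φ s)) :=
  factorAb_ab _ s

/-- `abel φ (e_x) = ab (φ x)`. [folklore] -/
@[simp] theorem abel_e3 (φ : SurfaceGroup 3 →* SurfaceGroup 3) (x : surfaceGen 3) :
    abel φ (e3 x) = toAdd (ab (φ (PresentedGroup.of x))) := by
  rw [← abel_ab, ab_of, toAdd_ofAdd]

/-- Functoriality: `abel (φ ∘ ψ) = abel φ ∘ abel ψ`. [folklore] -/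
theorem abel_comp (φ ψ : SurfaceGroup 3 →* SurfaceGroup 3) :
    abel (φ.comp ψ) = abel φ ∘ₗ abel ψ := by
  refine (Pi.basisFun ℤ (surfaceGen 3)).ext fun x => ?_
  rw [Pi.basisFun_apply, LinearMap.comp_apply]
  change abel (φ.comp ψ) (e3 x) = abel φ (abel ψ (e3 x))
  rw [abel_e3, abel_e3, abel_ab, MonoidHom.comp_apply]

/-- Functoriality: `abel id = id`. [folklore] -/
theorem abel_id : abel (MonoidHom.id (SurfaceGroup 3)) = LinearMap.id := by
  refine (Pi.basisFun ℤ (surfaceGen 3)).ext fun x => ?_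
  rw [Pi.basisFun_apply]
  change abel _ (e3 x) = e3 x
  rw [abel_e3, MonoidHom.id_apply, ab_of, toAdd_ofAdd]

/-- The automorphism of `ℤ⁶` induced by an automorphism of `S₃`. -/
def abelEquiv (α : SurfaceGroup 3 ≃* SurfaceGroup 3) : V3 ≃ₗ[ℤ] V3 :=
  LinearEquiv.ofLinear (abel α.toMonoidHom) (abel α.symm.toMonoidHom)
    (by rw [← abel_comp]; convert abel_id; ext; simp)
    (by rw [← abel_comp]; convert abel_id; ext; simp)

/-- `abelEquiv α` acts as `abel α`. [folklore] -/
@[simp] theorem abelEquiv_apply (α : SurfaceGroup 3 ≃* SurfaceGroup 3) (v : V3) :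
    abelEquiv α v = abel α.toMonoidHom v := rfl

/-- `abelEquiv α⁻¹ = (abelEquiv α)⁻¹`. [folklore] -/
@[simp] theorem abelEquiv_symm_apply (α : SurfaceGroup 3 ≃* SurfaceGroup 3) (v : V3) :
    (abelEquiv α).symm v = abel α.symm.toMonoidHom v := rfl

/-! ## Images of subgroups: integer lattices in `ℤ⁶` -/

/-- The image `L K ≤ ℤ⁶` of a subgroup `K ≤ S₃` under the abelianisation, as a `ℤ`-lattice. -/
def L (K : Subgroup (SurfaceGroup 3)) : Submodule ℤ V3 :=
  AddSubgroup.toIntSubmodule (Subgroup.toAddSubgroup' (K.map ab))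

/-- Membership in `L K`. [folklore] -/
theorem mem_L {K : Subgroup (SurfaceGroup 3)} {v : V3} :
    v ∈ L K ↔ ∃ k ∈ K, ab k = ofAdd v := by
  change v ∈ Subgroup.toAddSubgroup' (K.map ab) ↔ _
  rw [Subgroup.mem_toAddSubgroup', Subgroup.mem_map]

/-- `ab k ∈ L K` for `k ∈ K`. [folklore] -/
theorem toAdd_ab_mem_L {K : Subgroup (SurfaceGroup 3)} {k : SurfaceGroup 3} (hk : k ∈ K) :
    toAdd (ab k) ∈ L K :=
  mem_L.2 ⟨k, hk, by simp⟩

/-- `L` is monotone. [folklore] -/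
theorem L_mono {K K' : Subgroup (SurfaceGroup 3)} (h : K ≤ K') : L K ≤ L K' := fun _ hv => by
  obtain ⟨k, hk, e⟩ := mem_L.1 hv
  exact mem_L.2 ⟨k, h hk, e⟩

/-- `L (K ⊔ K') = L K ⊔ L K'`. [folklore] -/
theorem L_sup (K K' : Subgroup (SurfaceGroup 3)) : L (K ⊔ K') = L K ⊔ L K' := by
  simp only [L, Subgroup.map_sup, OrderIso.map_sup]

/-- `L S₃ = ℤ⁶`. [folklore] -/
theorem L_top : L (⊤ : Subgroup (SurfaceGroup 3)) = ⊤ := by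
  refine eq_top_iff.2 fun v _ => mem_L.2 ?_
  obtain ⟨s, hs⟩ := ab_surjective (ofAdd v)
  exact ⟨s, Subgroup.mem_top s, hs⟩

/-- Images commute with automorphisms: `L (α K) = abel α (L K)`. [folklore] -/
theorem L_map_equiv (α : SurfaceGroup 3 ≃* SurfaceGroup 3) (K : Subgroup (SurfaceGroup 3)) :
    L (K.map α.toMonoidHom) = (L K).map (abelEquiv α : V3 →ₗ[ℤ] V3) := by
  ext v
  simp only [mem_L, Submodule.mem_map, Subgroup.mem_map, MulEquiv.coe_toMonoidHom]
  constructor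
  · rintro ⟨_, ⟨k, hk, rfl⟩, hv⟩
    refine ⟨toAdd (ab k), ⟨k, hk, by simp⟩, ?_⟩
    rw [LinearEquiv.coe_coe, abelEquiv_apply, abel_ab, MulEquiv.coe_toMonoidHom, hv, toAdd_ofAdd]
  · rintro ⟨w, ⟨k, hk, hw⟩, rfl⟩
    refine ⟨α k, ⟨k, hk, rfl⟩, ?_⟩
    have hw' : w = toAdd (ab k) := by rw [hw, toAdd_ofAdd]
    subst hw'
    rw [LinearEquiv.coe_coe, abelEquiv_apply, abel_ab, MulEquiv.coe_toMonoidHom, ofAdd_toAdd]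

/-! ## Coordinate sublattices -/

/-- The coordinate submodule of vectors supported in `A` (spanned by the `e_x`, `x ∈ A`). -/
def coord (R : Type*) [CommRing R] (A : Finset (surfaceGen 3)) : Submodule R (surfaceGen 3 → R) where
  carrier := {v | ∀ x, x ∉ A → v x = 0}
  add_mem' ha hb x hx := by simp [ha x hx, hb x hx]
  zero_mem' _ _ := rfl
  smul_mem' c _ hv x hx := by simp [hv x hx]

/-- Membership in a coordinate submodule. [folklore] -/
@[simp] theorem mem_coord {R : Type*} [CommRing R] {A : Finset (surfaceGen 3)}
    {v : surfaceGen 3 → R} : v ∈ coord R A ↔ ∀ x, x ∉ A → v x = 0 := Iff.rfl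

/-- `Pi.single x n = n • e_x`. [folklore] -/
theorem single_eq_smul_e3 (x : surfaceGen 3) (n : ℤ) : Pi.single x n = n • e3 x := by
  ext y
  by_cases h : x = y
  · subst h; simp
  · simp [Pi.single_eq_of_ne' h]

/-- Off `A`, the coordinates of `ab k` vanish for `k` in the normal closure of the generators in
`A`. [folklore] -/
theorem ab_apply_eq_zero_of_mem_normalClosure {A : Finset (surfaceGen 3)} {k : SurfaceGroup 3}
    (hk : k ∈ Subgroup.normalClosure (PresentedGroup.of '' (A : Set (surfaceGen 3))))
    {x : surfaceGen 3} (hx : x ∉ A) : toAdd (ab k) x = 0 := by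
  let π : SurfaceGroup 3 →* Multiplicative ℤ :=
    (AddMonoidHom.toMultiplicative (Pi.evalAddMonoidHom (fun _ : surfaceGen 3 => ℤ) x)).comp ab
  have hle : Subgroup.normalClosure (PresentedGroup.of '' (A : Set (surfaceGen 3))) ≤ π.ker := by
    refine Subgroup.normalClosure_le_normal ?_
    rintro _ ⟨y, hy, rfl⟩
    have hyx : y ≠ x := fun h => hx (h ▸ hy)
    rw [SetLike.mem_coe, MonoidHom.mem_ker]
    change ofAdd (toAdd (ab (PresentedGroup.of y)) x) = 1
    rw [ab_of, toAdd_ofAdd, show e3 y x = 0 from Pi.single_eq_of_ne' hyx _]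
    rfl
  have h1 := hle hk
  rw [MonoidHom.mem_ker] at h1
  have h2 : toAdd (π k) = 0 := by rw [h1]; rfl
  exact h2

/-- **The image of a normal closure of generators is the coordinate sublattice**:
`L ⟪x : x ∈ A⟫ = coord ℤ A` (`ab` kills conjugation). [folklore] -/
theorem L_normalClosure_image (A : Finset (surfaceGen 3)) :
    L (Subgroup.normalClosure (PresentedGroup.of '' (A : Set (surfaceGen 3)))) = coord ℤ A := by
  ext v
  rw [mem_L, mem_coord]
  constructor
  · rintro ⟨k, hk, hv⟩ x hx
    have := ab_apply_eq_zero_of_mem_normalClosure hk hx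
    rwa [hv, toAdd_ofAdd] at this
  · intro hv
    suffices h : v ∈ L (Subgroup.normalClosure (PresentedGroup.of '' (A : Set (surfaceGen 3)))) from
      mem_L.1 h
    rw [← Finset.univ_sum_single v]
    refine Submodule.sum_mem _ fun x _ => ?_
    by_cases hx : x ∈ A
    · rw [single_eq_smul_e3]
      refine Submodule.smul_mem _ _ (mem_L.2 ⟨PresentedGroup.of x, ?_, ab_of x⟩)
      exact Subgroup.subset_normalClosure ⟨x, hx, rfl⟩
    · rw [hv x hx, Pi.single_zero]
      exact Submodule.zero_mem _

/-- **The standard kernels abelianise to the coordinate sublattices of their generators**: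
`L Nᵢ = coord ℤ (s4Gens i)` (`N₀ ↦ ⟨a₀,a₁,b₂⟩`, `N₁ ↦ ⟨a₀,b₁,a₂⟩`, `N₂ ↦ ⟨b₀,a₁,a₂⟩`). [folklore] -/
theorem L_s4Kernels : ∀ i : Fin 3, L (s4Kernels i) = coord ℤ (s4Gens i) := fun i => by
  rw [s4Kernels_eq]
  exact L_normalClosure_image _

/-! ## Prime levels: reduction mod `p` -/

section level

variable (p : ℕ)

/-- `H₁(Σ₃; ZMod p) = (ZMod p)⁶`. -/
abbrev V3p : Type := surfaceGen 3 → ZMod p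

/-- Reduction mod `p`, coordinatewise. -/
def red : V3 →ₗ[ℤ] V3p p where
  toFun v x := (v x : ZMod p)
  map_add' v w := by ext; simp
  map_smul' c v := by ext; simp

/-- `red` coordinatewise. [folklore] -/
@[simp] theorem red_apply (v : V3) (x : surfaceGen 3) : red p v x = (v x : ZMod p) := rfl

/-- `red (e_x) = ē_x`. [folklore] -/
@[simp] theorem red_e3 (x : surfaceGen 3) : red p (e3 x) = Pi.single x 1 := by
  ext y
  by_cases h : x = y
  · subst h; simp
  · simp [Pi.single_eq_of_ne' h]

/-- `red` is onto. [folklore] -/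
theorem red_surjective : Function.Surjective (red p) := fun w =>
  ⟨fun x => ZMod.cast (w x), funext fun x => by simp⟩

/-- `red v = 0` iff every coordinate is divisible by `p`. [folklore] -/
theorem red_eq_zero_iff (v : V3) : red p v = 0 ↔ ∀ x, (p : ℤ) ∣ v x := by
  simp only [funext_iff, red_apply, Pi.zero_apply, ZMod.intCast_zmod_eq_zero_iff_dvd]

/-- The mod-`p` reduction `Λ̄ ≤ (ZMod p)⁶` of an integer lattice `Λ ≤ ℤ⁶`, as a `ZMod p`-subspace. -/
def redSub (Λ : Submodule ℤ V3) : Submodule (ZMod p) (V3p p) :=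
  AddSubgroup.toZModSubmodule p (Λ.map (red p)).toAddSubgroup

/-- Membership in a reduced lattice. [folklore] -/
theorem mem_redSub {Λ : Submodule ℤ V3} {w : V3p p} : w ∈ redSub p Λ ↔ ∃ v ∈ Λ, red p v = w := by
  change w ∈ (Λ.map (red p)).toAddSubgroup ↔ _
  rw [Submodule.mem_toAddSubgroup, Submodule.mem_map]

/-- Reductions of lattice vectors lie in the reduced lattice. [folklore] -/
theorem red_mem_redSub {Λ : Submodule ℤ V3} {v : V3} (hv : v ∈ Λ) : red p v ∈ redSub p Λ :=
  (mem_redSub p).2 ⟨v, hv, rfl⟩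

/-- Coordinate lattices reduce to coordinate subspaces. [folklore] -/
theorem redSub_coord (A : Finset (surfaceGen 3)) : redSub p (coord ℤ A) = coord (ZMod p) A := by
  ext w
  rw [mem_redSub, mem_coord]
  constructor
  · rintro ⟨v, hv, rfl⟩ x hx
    simp [(mem_coord.1 hv) x hx]
  · intro hw
    refine ⟨fun x => ZMod.cast (w x), mem_coord.2 fun x hx => by simp [hw x hx], funext fun x => ?_⟩
    simp

end level

end Summit.SmoothPoincare4.SmoothPoincare4.Theorems.ShadowApproximation.EpiClassLivingston
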